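import Literature.NumberTheory.Automorphic.IrreducibleClasses                  -- ★ `SmoothIrrep`, ★ `IrrClass` (`mk`, `ind`, `mk_eq_mk_of_equiv`)
import Literature.NumberTheory.Automorphic.ParabolicInductionQuotientProofs    -- ★ `Representation.IsIrreducible.exists_equiv_quotient_finsupp`, ★ `Representation.Equiv.isSmooth`
import Literature.RepresentationTheory.Semisimple.SubrepresentationEquiv      -- ★ `Representation.isIrreducible_of_equiv`
import Mathlib.Logic.Small.Defs
import HarnessLib

/-!
# `Irr(G)` is a set: `IrrClass G` is `Small.{0}` (every irreducible representation is cyclic, hence a quotient of `ℂ[G]`)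

Topic `NumberTheory/Automorphic`; namespace `Literature.NumberTheory.Automorphic` (dot-notation extension of ★ `IrrClass`).  PROOFS ONLY; no definition,
no instance, no notation, no named fact, no `sorry`.

The tree's type of isomorphism classes of irreducible smooth complex representations ★ `IrrClass G` (`IrreducibleClasses.lean`, design note H9) lives in
`Type (u+1)` for `G : Type u`, because ★ `SmoothIrrep G` quantifies over its carrier `V : Type`.  Mathematically `Irr(G)` is a SET: an irreducible representation
`(ρ, V)` is CYCLIC — for `v ≠ 0` the map `(G →₀ ℂ) → V`, `δ_g ↦ ρ(g)v`, is onto — so `ρ ≅` a representation on `(G →₀ ℂ) ⧸ N`; the tree PROVES exactly this as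
★ `Representation.IsIrreducible.exists_equiv_quotient_finsupp` («its isomorphism class has a representative whose carrier lives in the universes of `G` and `k`
only», `ParabolicInductionQuotientProofs` § Small), and irreducibility ∕ smoothness pass along the equivalence (★ `isIrreducible_of_equiv`, ★ `Equiv.isSmooth`).
This file draws the conclusion the tree does not yet state: the pairs `(N, σ)` — a Type-0 type for `G : Type` — map ONTO `IrrClass G`, so `IrrClass G` is `Small.{0}`
(Mathlib `small_of_surjective`) [BernsteinZelevinsky1976, §2.1–2.5; BushnellHenniart2006, §1.1–1.2, §2.1].

WHY (cell `hodgecm-mathlib`, Track B ∕ K2-LIT, seat K2E1-p08 (g0), deal `K2E1SingletonPacketKitSplitPlaces`): the kit structure ★ `F0P3LocalPacketKit.LocalPacketKit` indexes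
local packets by a field `Pkt : Type`; any CONSTRUCTED kit whose packets are classes (the singleton kit of a split place, Rogawski §13.3 p. 201) needs a
Type-0 index in bijection with `IrrClass G` — Mathlib `Shrink (IrrClass G)` ∕ `equivShrink` through `IrrClass.small` (the consumer writes
`@Shrink (IrrClass G) (IrrClass.small G)`; no carrier is defined in Literature/).

CONTENTS: `IrrClass.exists_quotient_mk_eq` (every class is `⟦((G →₀ ℂ) ⧸ N, σ)⟧` with `σ` irreducible smooth) and **`IrrClass.small : Small.{0} (IrrClass G)`**.

References: [BernsteinZelevinsky1976] I. N. Bernstein, A. V. Zelevinsky, *Representations of the group GL(n, F) where F is a non-archimedean local field*,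
Russian Math. Surveys 31:3 (1976), §2.1–2.5; [BushnellHenniart2006] C. J. Bushnell, G. Henniart, *The local Langlands conjecture for GL(2)*, Grundlehren 335
(2006), §1.1–1.2 (the set `Irr(G)`), §2.1.
-/

noncomputable section

open scoped MonoidAlgebra

namespace Literature.NumberTheory.Automorphic

namespace IrrClass

open Literature.RepresentationTheory.Semisimple

variable (G : Type) [Group G] [TopologicalSpace G]

/-! ## §1 Every class has a representative on a quotient of `G →₀ ℂ`; `IrrClass G` is small -/

/-- **Every class `c ∈ Irr(G)` is the class of an irreducible smooth representation on a quotient `(G →₀ ℂ) ⧸ N`** (★ `exists_equiv_quotient_finsupp`: an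
irreducible `ρ` is cyclic, `δ_g ↦ ρ(g)v` is onto for `v ≠ 0`; irreducibility and smoothness transported along the equivalence).
[cite: BernsteinZelevinsky1976, §2.1–2.5] [cite: BushnellHenniart2006, §2.1] -/
theorem exists_quotient_mk_eq (c : IrrClass G) :
    ∃ (N : Submodule ℂ (G →₀ ℂ)) (σ : Representation ℂ G ((G →₀ ℂ) ⧸ N)) (hirr : σ.IsIrreducible) (hsm : σ.IsSmooth),
      IrrClass.mk ⟨(G →₀ ℂ) ⧸ N, σ, hirr, hsm⟩ = c := by
  induction c using IrrClass.ind with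
  | h r =>
    haveI : r.ρ.IsIrreducible := r.isIrreducible
    obtain ⟨N, σ, ⟨e⟩⟩ := Representation.IsIrreducible.exists_equiv_quotient_finsupp r.ρ
    exact ⟨N, σ, Representation.isIrreducible_of_equiv e, Representation.Equiv.isSmooth e r.isSmooth, (IrrClass.mk_eq_mk_of_equiv e).symm⟩

/-- **`Irr(G)` IS A SET**: ★ `IrrClass G` (a priori in `Type 1` for `G : Type`, since ★ `SmoothIrrep` quantifies over its carrier) is `Small.{0}` — the pairs
`(N, σ)` of §1, a Type-0 type, map ONTO it (Mathlib `small_of_surjective`).  Stated as a theorem, not an instance (use `haveI := IrrClass.small G`).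
[cite: BushnellHenniart2006, §1.1–1.2] [cite: BernsteinZelevinsky1976, §2.1–2.5] -/
theorem small : Small.{0} (IrrClass G) := by
  let α : Type := Σ N : Submodule ℂ (G →₀ ℂ), {σ : Representation ℂ G ((G →₀ ℂ) ⧸ N) // σ.IsIrreducible ∧ σ.IsSmooth}
  let F : α → IrrClass G := fun p => IrrClass.mk ⟨(G →₀ ℂ) ⧸ p.1, p.2.1, p.2.2.1, p.2.2.2⟩
  refine small_of_surjective (f := F) (fun c => ?_)
  obtain ⟨N, σ, hirr, hsm, hc⟩ := exists_quotient_mk_eq G c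
  exact ⟨⟨N, σ, hirr, hsm⟩, hc⟩

end IrrClass

end Literature.NumberTheory.Automorphic

end
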